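import Summits.BirchSwinnertonDyer.BirchSwinnertonDyer.Theses.CongruentShaFreeCut

/-!
# `Assembly` of route `CongruentShaFreeCut` (rung S2) — proved

`Assembly : RankPosOfTwoSelmerCorankOne → AnalyticRankOneOfRankOneFiniteShaTwo →
  Literature.NumberTheory.EllipticCurves.rankOne_twoConverse_congruentNumber`:
given `n ≠ 0` and `corank_{ℤ₂} Sel_{2^∞}(E_n) = 1`, crux A gives `rank ≥ 1`; the tree corank identity
`selmerCorank_eq_mordellWeilRank_add_holds 2` (`corank Sel = rank + corank Ш`) forces `rank = 1` and
`shaCorank 2 = 0`; `finite_primaryComponent_sha_iff_shaCorank_eq_zero` turns the latter into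
`Finite (Ш[2^∞])`; crux B returns `analyticRank = 1`. Pure logic over two tree theorems.
-/

namespace Summit.BirchSwinnertonDyer.BirchSwinnertonDyer.Theorems.CongruentShaFreeCutAssembly

open Literature.NumberTheory.EllipticCurves
open Summit.BirchSwinnertonDyer.BirchSwinnertonDyer.Theses.CongruentShaFreeCut

/-- The route's `Assembly` item holds (closes `stmt-BirchSwinnertonDyer-19081`). -/
theorem assembly_holds :
    Summit.BirchSwinnertonDyer.BirchSwinnertonDyer.Theses.CongruentShaFreeCut.Assembly := by
  intro hA hB n hn hcorank
  haveI := isElliptic_congruentNumberCurve hn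
  haveI : Fact (Nat.Prime 2) := ⟨Nat.prime_two⟩
  have hadd := (congruentNumberCurve n).selmerCorank_eq_mordellWeilRank_add_holds 2
  have hpos := hA hn hcorank
  have hrank : (congruentNumberCurve n).mordellWeilRank = 1 := by omega
  have hsha : (congruentNumberCurve n).shaCorank 2 = 0 := by omega
  exact hB hn hrank ((finite_primaryComponent_sha_iff_shaCorank_eq_zero _ 2).2 hsha)

end Summit.BirchSwinnertonDyer.BirchSwinnertonDyer.Theorems.CongruentShaFreeCutAssembly
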